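import Literature.AlgebraicGeometry.Motives.MonomialLinearSystemIncidenceFamily
import HarnessLib

/-!
# The total space of the universal family of smooth `M`-supported hypersurfaces is quasi-projective

Family `hodge`, layer `Literature/AlgebraicGeometry/Motives`. ONE THEOREM (no definition, no named fact):
`isQuasiProjectiveOver_totalM` — for a field `k`, `n`, `d > 0` and a set `M` of degree-`d` exponents, the total
space `𝒴_M = totalM k n d M` of the smooth `M`-supported family `familyM` (`Motives/MonomialSupportedHypersurfaceFamily`)
is quasi-projective over `k`: it is an open subscheme (`totalMToIncidence`,
`isOpenImmersion_totalMToIncidence_left`, file `MonomialLinearSystemIncidenceFamily`) of the incidence variety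
`W_M ⊆ ℙⁿ⁺¹ × 𝔸^M`, which is quasi-projective (`isQuasiProjectiveOver_incidenceOverM`); Voisin II §6.2.1 / §2.1.1
("`Z → X` is a projective bundle"; the smooth family is its restriction over the open set `B`), Hartshorne II §4.

Consumer: the Hodge-generic monodromy theorem `deligne_finiteIndex_monodromy_le_mumfordTateGroup_of_isQuasiProjectiveOver`
(file `HodgeTheory/AlgebraicMonodromyMumfordTateOfQuasiProjective`) applied to `familyM` — the crux
`VeryGeneralSignCommutatorsInHg` of route `Summits/HodgeConjecture/HodgeConjecture/Theses/SignSymmetricPowers.lean`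
(stmt-HodgeConjecture-19716) then no longer needs the named fact `deligne_finiteIndex_monodromy_le_mumfordTateGroup`.

## References
* [VoisinHodgeII2003] C. Voisin, Hodge Theory and Complex Algebraic Geometry II, CUP 2003, §2.1.1, §6.2.1.
* [Hartshorne1977] R. Hartshorne, Algebraic Geometry, GTM 52, II §4 (quasi-projective morphisms, p. 103).
-/

noncomputable section

open CategoryTheory AlgebraicGeometry

universe u

namespace Literature.AlgebraicGeometry.Motives.UniversalHypersurface

/-- **`𝒴_M = totalM k n d M` is quasi-projective over `k`** (`d > 0`): the open immersion
`𝒴_M ↪ W_M` into the quasi-projective incidence variety, composed with an open immersion of `W_M` into a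
projective `k`-scheme. [cite: VoisinHodgeII2003, §6.2.1] [cite: Hartshorne1977, II §4 (p. 103)] -/
theorem isQuasiProjectiveOver_totalM (k : Type u) [Field k] (n d : ℕ) (M : Set (DegIndex n d)) (hd : 0 < d) :
    HodgeTheory.IsQuasiProjectiveOver (totalM k n d M) := by
  obtain ⟨P, j, hP, hj⟩ := isQuasiProjectiveOver_incidenceOverM k n d M
  haveI := hj
  refine ⟨P, totalMToIncidence k n d M hd ≫ j, hP, ?_⟩
  rw [Over.comp_left]
  infer_instance

end Literature.AlgebraicGeometry.Motives.UniversalHypersurface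

end
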